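import Mathlib.Data.Real.Basic
import Mathlib.Data.Sign.Basic
import Mathlib.Data.Rat.BigOperators
import Mathlib.Algebra.Order.BigOperators.Group.Finset
import Mathlib.Algebra.BigOperators.Ring.Finset
import Mathlib.Tactic.Ring
import Mathlib.Tactic.Linarith
import Mathlib.Tactic.Positivity
import Mathlib.Tactic.FieldSimp
import Mathlib.Tactic.LinearCombination
import HarnessLib

/-!
# Fournier–Koiran point location, I: location certificates and their correctness

Topic `Literature/Computability/Complexity`, grouping namespace `FKPointLocation` (the construction
of Fournier–Koiran, *Lower bounds are not easier over the reals: inside PH*, ICALP 2000 = LIP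
RR-1999-21, §2, after Meyer auf der Heide). This file is the MACHINE-FREE core of the correctness
proof of the transfer theorem `NDP⁰_ℝovs ⊆ P⁰_ℝovs(NP)` (Thm 3) in the tree's sign-oracle rendering
(`AdditiveRealClasses.lean`, `FournierKoiranTransfer.lean`).

Setting (report §2.1–2.4, homogenised as in §2.3): a point `x̂ ∈ ℝ^D` and the family `𝓛_B` of
integer linear forms `ℓ_a(y) = ∑ aᵢ yᵢ` with `|aᵢ| ≤ B`. The point-location procedure walks down
charts `G₀ = ℝ^D ⊋ G₁ ⊋ ⋯` (each `G_{j+1}` fixes one more coordinate to `±1`: a facet of the unit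
cube of `G_j`), projecting the current point `x^{(j)}` centrally from an APEX `s_j` onto that facet
("pyramids", Lemma 2 of the report), after having located `x^{(j)}` in a little cube around a dyadic
centre `p_j` (binary search) and chosen `s_j` as a common point of all live forms passing near that
cube (coarseness). We record the outcome as a **location certificate** `Cert` (centres `p_j`, radii
`ρ_j`, apexes `s_j`, exit facets `(i*_j, ε*_j)`, depth `J`) and isolate the properties the procedure
guarantees as `Cert.Valid`. The main theorem `Cert.sign_lin_xStar_eq` says that the explicit RATIONAL
point `x* = xStar 0` obtained by "un-projecting" the last apex through all the pyramids with tiny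
ratios `μ_j = ρ_j/16` lies in the same face of the arrangement `𝒜(𝓛_B)` as `x̂`:
`sign ℓ_a(x*) = sign ℓ_a(x̂)` for every `|a|_∞ ≤ B`. (The report instead collects the tests into a
locating system and finishes with linear programming / a guessed small rational point, p. 11; the
explicit un-projection is this tree's rendering of "guess a rational point of `P_S`".)

Contents: `lin`, `InCube`, `Meets`; `Cert`, `Cert.chart`, `Cert.xProj` (the projected points
`x^{(j)}`), `Cert.exitParam`, `Cert.xStarRev`/`Cert.xStar`, `Cert.Live` (the live families
`Λ_j = {a : |a|_∞ ≤ B, a·s_{j'} = 0 ∀ j' < j}`), `Cert.Valid`; lemmas `sign_lin_eq_of_not_meets`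
(an affine form without zero on a cube has constant sign there), `Cert.xProj_mem_unitCube`,
`Cert.sign_lin_xProj` (upward invariant), `Cert.sign_lin_xStarRev` (downward invariant), and the
theorem `Cert.sign_lin_xStar_eq`.

Not here: how a valid certificate is FOUND (binary search, stable scales and coarseness, NP prefix
searches: files `FKPointLocationStableScale`, `FKPointLocationProtocol*`), sizes, machines.

## References

* H. Fournier, P. Koiran, *Lower bounds are not easier over the reals: inside PH*, ICALP 2000,
  LNCS 1853 = LIP RR-1999-21: §2.1 (Lemma 2: pyramids `P(s, A)` and the test substitution
  `h' ↦ Aff(s, h')`; the recursion on the dimension), §2.3 (homogenisation), §2.4 and p. 11 (location,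
  small rational point). [FournierKoiran2000]
* F. Meyer auf der Heide, *Fast algorithms for n-dimensional restrictions of hard problems*, J. ACM
  35 (1988), §2–3 (the original construction). [MeyerAufDerHeide1988]
-/

namespace Literature.Computability.Complexity

namespace FKPointLocation

open Finset

variable {D : ℕ}

/-! ### Linear forms, cubes inside charts -/

/-- The integer linear form `ℓ_a(y) = ∑ᵢ aᵢ yᵢ` on `ℝ^D`. [cite: FournierKoiran2000, §2 (tests are integer forms)] -/
def lin (a : Fin D → ℤ) (y : Fin D → ℝ) : ℝ := ∑ i, (a i : ℝ) * y i

/-- `lin` is additive in the point. [folklore] -/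
theorem lin_add (a : Fin D → ℤ) (y z : Fin D → ℝ) : lin a (y + z) = lin a y + lin a z := by
  simp only [lin, Pi.add_apply, mul_add, sum_add_distrib]

/-- `lin` is homogeneous in the point. [folklore] -/
theorem lin_smul (a : Fin D → ℤ) (c : ℝ) (y : Fin D → ℝ) : lin a (c • y) = c * lin a y := by
  simp only [lin, Pi.smul_apply, smul_eq_mul, mul_sum]
  exact sum_congr rfl fun i _ => by ring

/-- `lin` on a difference. [folklore] -/
theorem lin_sub (a : Fin D → ℤ) (y z : Fin D → ℝ) : lin a (y - z) = lin a y - lin a z := by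
  simp only [lin, Pi.sub_apply, mul_sub, sum_sub_distrib]

/-- Value of `lin` along the pyramid parametrisation `s + c • (y - s)`. [cite: FournierKoiran2000, §2.1 Lemma 2] -/
theorem lin_apex (a : Fin D → ℤ) (s y : Fin D → ℝ) (c : ℝ) :
    lin a (s + c • (y - s)) = lin a s + c * (lin a y - lin a s) := by
  rw [lin_add, lin_smul, lin_sub]

/-- A CHART is a sign pattern `χ : Fin D → ℤ` (`χ i = 0`: free coordinate; `χ i = ±1`: the
coordinate is fixed to that value); `InCube χ p ρ y` says that `y` lies in the chart and in the
sup-norm cube of radius `ρ` around `p` in the free coordinates. [cite: FournierKoiran2000, §2.1 (little cubes of the cube `C_n^k` of an affine coordinate subspace)] -/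
def InCube (χ : Fin D → ℤ) (p : Fin D → ℚ) (ρ : ℚ) (y : Fin D → ℝ) : Prop :=
  (∀ i, χ i ≠ 0 → y i = χ i) ∧ ∀ i, χ i = 0 → |y i - p i| ≤ ρ

/-- `Meets χ p ρ a`: the trace of the hyperplane `ℓ_a = 0` on the chart meets the little cube
`InCube χ p ρ`. [cite: FournierKoiran2000, §2.1 (`H_n^k`: hyperplanes intersecting the little cube)] -/
def Meets (χ : Fin D → ℤ) (p : Fin D → ℚ) (ρ : ℚ) (a : Fin D → ℤ) : Prop :=
  ∃ y : Fin D → ℝ, InCube χ p ρ y ∧ lin a y = 0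

/-- A cube in a chart is convex. [folklore] -/
theorem inCube_convex {χ : Fin D → ℤ} {p : Fin D → ℚ} {ρ : ℚ} {u v : Fin D → ℝ}
    (hu : InCube χ p ρ u) (hv : InCube χ p ρ v) {t : ℝ} (ht0 : 0 ≤ t) (ht1 : t ≤ 1) :
    InCube χ p ρ ((1 - t) • u + t • v) := by
  refine ⟨fun i hi => ?_, fun i hi => ?_⟩
  · simp only [Pi.add_apply, Pi.smul_apply, smul_eq_mul, hu.1 i hi, hv.1 i hi]; ring
  · have h1 := hu.2 i hi
    have h2 := hv.2 i hi
    have : ((1 - t) • u + t • v) i - p i = (1 - t) * (u i - p i) + t * (v i - p i) := by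
      simp only [Pi.add_apply, Pi.smul_apply, smul_eq_mul]; ring
    rw [this]
    calc |(1 - t) * (u i - p i) + t * (v i - p i)|
        ≤ |(1 - t) * (u i - p i)| + |t * (v i - p i)| := abs_add_le _ _
      _ = (1 - t) * |u i - p i| + t * |v i - p i| := by
          rw [abs_mul, abs_mul, abs_of_nonneg (by linarith), abs_of_nonneg ht0]
      _ ≤ (1 - t) * ρ + t * ρ := add_le_add (mul_le_mul_of_nonneg_left h1 (by linarith))
          (mul_le_mul_of_nonneg_left h2 ht0)
      _ = ρ := by ring

/-- **A form without zero on a (convex) cube has constant non-zero sign there**: if `ℓ_a` does not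
vanish on `InCube χ p ρ` then any two points of it give the same `sign (ℓ_a ·)` (intermediate value
along the segment, explicit for affine functions). [cite: FournierKoiran2000, §2.1 (case (i): a little cube missed by all hyperplanes lies in one cell)] -/
theorem sign_lin_eq_of_not_meets {χ : Fin D → ℤ} {p : Fin D → ℚ} {ρ : ℚ} {a : Fin D → ℤ}
    (h : ¬ Meets χ p ρ a) {u v : Fin D → ℝ} (hu : InCube χ p ρ u) (hv : InCube χ p ρ v) :
    SignType.sign (lin a u) = SignType.sign (lin a v) := by
  have hu0 : lin a u ≠ 0 := fun h0 => h ⟨u, hu, h0⟩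
  have hv0 : lin a v ≠ 0 := fun h0 => h ⟨v, hv, h0⟩
  by_contra hne
  -- the signs are opposite, so the form vanishes at a convex combination of `u` and `v`
  have hcomb : |lin a v| * lin a u + |lin a u| * lin a v = 0 := by
    rcases lt_or_gt_of_ne hu0 with hu' | hu'
    · rcases lt_or_gt_of_ne hv0 with hv' | hv'
      · exact absurd ((sign_neg hu').trans (sign_neg hv').symm) hne
      · rw [abs_of_pos hv', abs_of_neg hu']; ring
    · rcases lt_or_gt_of_ne hv0 with hv' | hv'
      · rw [abs_of_neg hv', abs_of_pos hu']; ring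
      · exact absurd ((sign_pos hu').trans (sign_pos hv').symm) hne
  have hsum : 0 < |lin a u| + |lin a v| := by positivity
  set t : ℝ := |lin a u| / (|lin a u| + |lin a v|) with ht
  have ht0 : 0 ≤ t := div_nonneg (abs_nonneg _) hsum.le
  have ht1 : t ≤ 1 := div_le_one_of_le₀ (by linarith [abs_nonneg (lin a v)]) hsum.le
  have h1t : 1 - t = |lin a v| / (|lin a u| + |lin a v|) := by
    rw [ht, eq_div_iff hsum.ne', sub_mul, div_mul_cancel₀ _ hsum.ne']; ring
  have hzero : lin a ((1 - t) • u + t • v) = 0 := by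
    rw [lin_add, lin_smul, lin_smul, h1t, ht, div_mul_eq_mul_div, div_mul_eq_mul_div,
      ← add_div, hcomb, zero_div]
  exact h ⟨(1 - t) • u + t • v, inCube_convex hu hv ht0 ht1, hzero⟩

/-! ### Location certificates -/

/-- A **location certificate** for a point of `ℝ^D`: the depth `J`, and for every level `j` the
dyadic centre `p_j`, the radius `ρ_j`, the apex `s_j`, and the exit facet `(i*_j, ε*_j)` of the
pyramid step `j → j+1` (fields at indices `> J`, and `p₀, ρ₀, i*_J, ε*_J`, are never read).
[cite: FournierKoiran2000, §2.1 (the data `c_n^k`, `s_n^k`, `i_k`, `ε_k` of step `k`)] -/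
structure Cert (D : ℕ) where
  /-- depth: the level at which the projected point hits the apex -/
  J : ℕ
  /-- centre of the little cube at level `j ≥ 1` -/
  p : ℕ → Fin D → ℚ
  /-- radius `ρ_j` of the region `Q_j` at level `j ≥ 1` -/
  ρ : ℕ → ℚ
  /-- apex `s_j` (`s_0 = 0`) -/
  s : ℕ → Fin D → ℚ
  /-- coordinate fixed by the step `j → j+1` -/
  istar : ℕ → Fin D
  /-- value `±1` it is fixed to -/
  εstar : ℕ → ℤ

namespace Cert

variable (Γ : Cert D)

/-- The chart of level `j`: `χ₀ = 0` (nothing fixed), `χ_{j+1} = χ_j[i*_j ↦ ε*_j]`.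
[cite: FournierKoiran2000, §2.1 (the affine space `{x_{i_1} = ε_1, …, x_{i_{k-1}} = ε_{k-1}}` of step `k`)] -/
def chart (Γ : Cert D) : ℕ → Fin D → ℤ
  | 0 => 0
  | j + 1 => Function.update (chart Γ j) (Γ.istar j) (Γ.εstar j)

/-- The apex of level `j` as a real vector. [folklore] -/
def sR (j : ℕ) : Fin D → ℝ := fun i => (Γ.s j i : ℝ)

/-- **The projected points** `x^{(0)} = x̂`, `x^{(j+1)} = s_j + μ*_j (x^{(j)} - s_j)` with the exit
parameter `μ*_j = (1 - ε*_j s_{j,i*}) / |x^{(j)}_{i*} - s_{j,i*}|` (the point where the ray from the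
apex through `x^{(j)}` leaves the unit cube of the chart, through the facet `y_{i*} = ε*`).
[cite: FournierKoiran2000, §2.1 (the point `(s_n^k x) ∩ f_n^k`)] -/
noncomputable def xProj (Γ : Cert D) (xh : Fin D → ℝ) : ℕ → Fin D → ℝ
  | 0 => xh
  | j + 1 =>
    Γ.sR j + ((1 - (Γ.εstar j : ℝ) * Γ.sR j (Γ.istar j)) /
      |xProj Γ xh j (Γ.istar j) - Γ.sR j (Γ.istar j)|) • (xProj Γ xh j - Γ.sR j)

/-- The exit parameter `μ*_j`. [cite: FournierKoiran2000, §2.1] -/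
noncomputable def exitParam (xh : Fin D → ℝ) (j : ℕ) : ℝ :=
  (1 - (Γ.εstar j : ℝ) * Γ.sR j (Γ.istar j)) / |Γ.xProj xh j (Γ.istar j) - Γ.sR j (Γ.istar j)|

/-- Unfolding of the projection step. [folklore] -/
theorem xProj_succ (xh : Fin D → ℝ) (j : ℕ) :
    Γ.xProj xh (j + 1) = Γ.sR j + Γ.exitParam xh j • (Γ.xProj xh j - Γ.sR j) := rfl

/-- The un-projection ratio: `μ_0 = 1`, `μ_j = ρ_j / 16` for `j ≥ 1`. [folklore] -/
def μ (j : ℕ) : ℚ := if j = 0 then 1 else Γ.ρ j / 16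

/-- **The un-projected points**, from the bottom: `xStarRev k = x*^{(J-k)}` with `x*^{(J)} = s_J` and
`x*^{(j)} = s_j + μ_j (x*^{(j+1)} - s_j)`. [cite: FournierKoiran2000, p. 11 ("guessing a rational point `q ∈ P_S` with small coordinates"), here made explicit] -/
def xStarRev (Γ : Cert D) : ℕ → Fin D → ℚ
  | 0 => Γ.s Γ.J
  | k + 1 => Γ.s (Γ.J - (k + 1)) + Γ.μ (Γ.J - (k + 1)) • (xStarRev Γ k - Γ.s (Γ.J - (k + 1)))

/-- `x*^{(j)} = xStarRev (J - j)` (for `j ≤ J`); the located rational point is `xStar 0`. [folklore] -/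
def xStar (j : ℕ) : Fin D → ℚ := Γ.xStarRev (Γ.J - j)

/-- The LIVE family of level `j`: forms with `|a|_∞ ≤ B` vanishing at all earlier apexes
(`Λ_{j+1} = {ℓ ∈ Λ_j : ℓ(s_j) = 0}`; with `s_0 = 0`, `Λ_0 = Λ_1 = 𝓛_B`).
[cite: FournierKoiran2000, §2.1 (`H_n^k ⊆ H_n^{k-1}`, all through `s_n^k`)] -/
def Live (B : ℕ) (j : ℕ) (a : Fin D → ℤ) : Prop :=
  (∀ i, (a i).natAbs ≤ B) ∧ ∀ j' < j, ∑ i, (a i : ℚ) * Γ.s j' i = 0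

/-- **Validity of a certificate** for `x̂` (what the location procedure guarantees): `s_0 = 0`;
radii `0 < ρ_j`, `4r ≤ ρ_j ≤ 1`; `s_j` lies in the chart, within `ρ_j/4` of `p_j`; `x^{(j)}` within `r` of
`p_j` (binary search); the APEX PROPERTY — every live form whose trace meets the cube of radius
`ρ_j` around `p_j` vanishes at `s_j` (stable scale + coarseness); the exit facet is a free
coordinate, `ε*` is the sign of the direction, and `i*` minimises the hitting parameter; and the
bottom `x^{(J)} = s_J`. [cite: FournierKoiran2000, §2.1 (Steps 1 and k; cases (i)/(ii); choice of the face `f_n^k`)] -/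
structure Valid (xh : Fin D → ℝ) (B : ℕ) (r : ℚ) : Prop where
  /-- the level-0 apex is the origin (homogenisation, §2.3) -/
  s_zero : Γ.s 0 = 0
  /-- `0 ≤ r` -/
  r_nonneg : 0 ≤ r
  /-- `0 < ρ_j`, `4r ≤ ρ_j ≤ 1` -/
  rho : ∀ j, 1 ≤ j → j ≤ Γ.J → 0 < Γ.ρ j ∧ r ≤ Γ.ρ j / 4 ∧ Γ.ρ j ≤ 1
  /-- `s_j ∈ G_j` -/
  s_fixed : ∀ j, 1 ≤ j → j ≤ Γ.J → ∀ i, Γ.chart j i ≠ 0 → Γ.s j i = Γ.chart j i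
  /-- `|s_j - p_j|_∞ ≤ ρ_j / 4` on free coordinates -/
  s_near : ∀ j, 1 ≤ j → j ≤ Γ.J → ∀ i, Γ.chart j i = 0 → |Γ.s j i - Γ.p j i| ≤ Γ.ρ j / 4
  /-- `|x^{(j)} - p_j|_∞ ≤ r` on free coordinates -/
  x_near : ∀ j, 1 ≤ j → j ≤ Γ.J → ∀ i, Γ.chart j i = 0 → |Γ.xProj xh j i - Γ.p j i| ≤ r
  /-- apex property -/
  apex : ∀ j, 1 ≤ j → j ≤ Γ.J → ∀ a, Γ.Live B j a → Meets (Γ.chart j) (Γ.p j) (Γ.ρ j) a →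
    ∑ i, (a i : ℚ) * Γ.s j i = 0
  /-- the exit coordinate is free -/
  exit_free : ∀ j < Γ.J, Γ.chart j (Γ.istar j) = 0
  /-- `ε*` is the sign of the direction at `i*` -/
  exit_sign : ∀ j < Γ.J,
    (0 < Γ.xProj xh j (Γ.istar j) - Γ.sR j (Γ.istar j) ∧ Γ.εstar j = 1) ∨
    (Γ.xProj xh j (Γ.istar j) - Γ.sR j (Γ.istar j) < 0 ∧ Γ.εstar j = -1)
  /-- `i*` minimises the hitting parameter among moving free coordinates -/
  exit_min : ∀ j < Γ.J, ∀ i, Γ.chart j i = 0 →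
    (0 < Γ.xProj xh j i - Γ.sR j i →
      Γ.exitParam xh j ≤ (1 - Γ.sR j i) / (Γ.xProj xh j i - Γ.sR j i)) ∧
    (Γ.xProj xh j i - Γ.sR j i < 0 →
      Γ.exitParam xh j ≤ (1 + Γ.sR j i) / (Γ.sR j i - Γ.xProj xh j i))
  /-- bottom: the projected point is the apex -/
  bottom : Γ.xProj xh Γ.J = Γ.sR Γ.J


variable {Γ : Cert D} {xh : Fin D → ℝ} {B : ℕ} {r : ℚ}

/-! ### Charts -/

/-- Unfolding of `chart (j+1)`. [folklore] -/
theorem chart_succ_apply (Γ : Cert D) (j : ℕ) (i : Fin D) :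
    Γ.chart (j + 1) i = if i = Γ.istar j then Γ.εstar j else Γ.chart j i := by
  simp only [chart, Function.update_apply]

/-- `chart 0 = 0`. [folklore] -/
@[simp] theorem chart_zero (Γ : Cert D) (i : Fin D) : Γ.chart 0 i = 0 := rfl

/-- The level-0 apex is `0`. [folklore] -/
theorem sR_zero (hV : Γ.Valid xh B r) : Γ.sR 0 = 0 := by
  funext i; simp [sR, hV.s_zero]

/-- Apexes lie in their chart. [cite: FournierKoiran2000, §2.1] -/
theorem sR_fixed (hV : Γ.Valid xh B r) {j : ℕ} (hj : j ≤ Γ.J) {i : Fin D} (h : Γ.chart j i ≠ 0) :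
    Γ.sR j i = Γ.chart j i := by
  rcases Nat.eq_zero_or_pos j with rfl | hpos
  · simp at h
  · have := hV.s_fixed j hpos hj i h
    simp only [sR, this, Rat.cast_intCast]

/-- A coordinate fixed at level `j < J` stays fixed, with the same value, at level `j+1`. [folklore] -/
theorem chart_succ_of_ne_zero (hV : Γ.Valid xh B r) {j : ℕ} (hj : j < Γ.J) {i : Fin D}
    (h : Γ.chart j i ≠ 0) : Γ.chart (j + 1) i = Γ.chart j i := by
  rw [chart_succ_apply, if_neg]
  rintro rfl
  exact h (hV.exit_free j hj)

/-- Chart values are `0, 1, -1`. [folklore] -/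
theorem chart_trichotomy (hV : Γ.Valid xh B r) :
    ∀ j, j ≤ Γ.J → ∀ i, Γ.chart j i = 0 ∨ Γ.chart j i = 1 ∨ Γ.chart j i = -1 := by
  intro j
  induction j with
  | zero => intro _ i; left; rfl
  | succ j ih =>
    intro hj i
    rw [chart_succ_apply]
    split_ifs with h
    · rcases hV.exit_sign j (by omega) with ⟨-, h1⟩ | ⟨-, h1⟩
      · right; left; exact h1
      · right; right; exact h1
    · exact ih (by omega) i

/-! ### The projected points stay in the unit cubes -/

/-- Facts about the exit step `j → j+1` (`j < J`), given that `x^{(j)}_{i*}` lies in `[-1,1]` when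
`j ≥ 1`: the direction at `i*` is non-zero, `ε* d_{i*} = |d_{i*}|`, `ε*² = 1`, the numerator
`1 - ε* s_{j,i*}` is positive, `μ*_j > 0`, and `μ*_j ≥ 1` when `j ≥ 1`.
[cite: FournierKoiran2000, §2.1 (choice of the face of the cube hit by the ray from the apex)] -/
theorem exit_facts (hV : Γ.Valid xh B r) {j : ℕ} (hj : j < Γ.J)
    (hc : 1 ≤ j → |Γ.xProj xh j (Γ.istar j)| ≤ 1) :
    Γ.xProj xh j (Γ.istar j) - Γ.sR j (Γ.istar j) ≠ 0 ∧
    (Γ.εstar j : ℝ) * (Γ.xProj xh j (Γ.istar j) - Γ.sR j (Γ.istar j)) =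
      |Γ.xProj xh j (Γ.istar j) - Γ.sR j (Γ.istar j)| ∧
    (Γ.εstar j : ℝ) * (Γ.εstar j : ℝ) = 1 ∧
    0 < 1 - (Γ.εstar j : ℝ) * Γ.sR j (Γ.istar j) ∧
    0 < Γ.exitParam xh j ∧ (1 ≤ j → 1 ≤ Γ.exitParam xh j) := by
  set y := Γ.xProj xh j (Γ.istar j) with hy
  set σ := Γ.sR j (Γ.istar j) with hσ
  have hσ0 : j = 0 → σ = 0 := by rintro rfl; rw [hσ, sR_zero hV]; rfl
  have key : ∀ (ε : ℝ), (ε = 1 ∧ 0 < y - σ) ∨ (ε = -1 ∧ y - σ < 0) →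
      y - σ ≠ 0 ∧ ε * (y - σ) = |y - σ| ∧ ε * ε = 1 ∧ 0 < 1 - ε * σ ∧
      0 < (1 - ε * σ) / |y - σ| ∧ (1 ≤ j → 1 ≤ (1 - ε * σ) / |y - σ|) := by
    rintro ε (⟨rfl, hd⟩ | ⟨rfl, hd⟩)
    · have habs : |y - σ| = y - σ := abs_of_pos hd
      have hν : 0 < 1 - 1 * σ ∧ (1 ≤ j → y - σ ≤ 1 - 1 * σ) := by
        rcases Nat.eq_zero_or_pos j with h0 | hpos
        · refine ⟨by rw [hσ0 h0]; norm_num, fun h => by omega⟩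
        · have h1 : y ≤ 1 := (abs_le.1 (hc hpos)).2
          exact ⟨by linarith, fun _ => by linarith⟩
      refine ⟨hd.ne', by rw [habs, one_mul], by norm_num, hν.1, by rw [habs]; exact div_pos hν.1 hd,
        fun h1 => ?_⟩
      rw [habs, one_le_div hd]
      exact hν.2 h1
    · have habs : |y - σ| = -(y - σ) := abs_of_neg hd
      have hν : 0 < 1 - (-1) * σ ∧ (1 ≤ j → -(y - σ) ≤ 1 - (-1) * σ) := by
        rcases Nat.eq_zero_or_pos j with h0 | hpos
        · refine ⟨by rw [hσ0 h0]; norm_num, fun h => by omega⟩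
        · have h1 : -1 ≤ y := (abs_le.1 (hc hpos)).1
          exact ⟨by linarith, fun _ => by linarith⟩
      refine ⟨hd.ne, by rw [habs]; ring, by norm_num, hν.1,
        by rw [habs]; exact div_pos hν.1 (by linarith), fun h1 => ?_⟩
      rw [habs, one_le_div (by linarith)]
      exact hν.2 h1
  have hex := hV.exit_sign j hj
  rcases hex with ⟨hd, he⟩ | ⟨hd, he⟩
  · have := key 1 (Or.inl ⟨rfl, hd⟩)
    simp only [exitParam, he, Int.cast_one, ← hy, ← hσ]
    exact this
  · have := key (-1) (Or.inr ⟨rfl, hd⟩)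
    simp only [exitParam, he, Int.cast_neg, Int.cast_one, ← hy, ← hσ]
    exact this

/-- One pyramid step keeps the point in the unit cube of the next chart.
[cite: FournierKoiran2000, §2.1 (the projected point lies on the face `f_n^k ⊆ [-1,1]^{n-k}`)] -/
theorem xProj_succ_mem (hV : Γ.Valid xh B r) {j : ℕ} (hj : j < Γ.J)
    (hfix : ∀ i, Γ.chart j i ≠ 0 → Γ.xProj xh j i = Γ.chart j i)
    (hcube : 1 ≤ j → ∀ i, |Γ.xProj xh j i| ≤ 1) :
    (∀ i, Γ.chart (j + 1) i ≠ 0 → Γ.xProj xh (j + 1) i = Γ.chart (j + 1) i) ∧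
    ∀ i, |Γ.xProj xh (j + 1) i| ≤ 1 := by
  obtain ⟨hd0, hεd, hεε, hν, hcpos, hc1⟩ := exit_facts hV hj (fun h => hcube h _)
  set c := Γ.exitParam xh j with hc
  set y := Γ.xProj xh j with hy
  set s := Γ.sR j with hs
  set i₀ := Γ.istar j with hi₀
  set ε : ℝ := (Γ.εstar j : ℝ) with hε
  have hs0 : j = 0 → s = 0 := by rintro rfl; exact sR_zero hV
  have hstep : ∀ i, Γ.xProj xh (j + 1) i = s i + c * (y i - s i) := by
    intro i; rw [xProj_succ]; rfl
  -- the exit coordinate lands on `ε`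
  have hε0 : ε ≠ 0 := by
    intro h0; rw [h0, mul_zero] at hεε; exact zero_ne_one hεε
  have hi₀val : Γ.xProj xh (j + 1) i₀ = ε := by
    have h1 : c * (y i₀ - s i₀) = (1 - ε * s i₀) * ε := by
      rw [hc, exitParam, ← hy, ← hs, ← hi₀, ← hε, ← hεd, div_mul_eq_mul_div,
        mul_div_mul_right _ _ hd0, div_eq_iff hε0, mul_assoc, hεε, mul_one]
    rw [hstep, h1]
    linear_combination (-(s i₀)) * hεε
  have hεabs : |ε| = 1 := by
    rcases hV.exit_sign j hj with ⟨-, h1⟩ | ⟨-, h1⟩ <;> simp [hε, h1]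
  -- fixed coordinates do not move
  have hfixed : ∀ i, Γ.chart j i ≠ 0 → Γ.xProj xh (j + 1) i = Γ.chart j i := by
    intro i hi
    have h1 : y i = Γ.chart j i := hfix i hi
    have h2 : s i = Γ.chart j i := sR_fixed hV hj.le hi
    rw [hstep, h1, h2]; ring
  refine ⟨fun i hi => ?_, fun i => ?_⟩
  · rw [chart_succ_apply] at hi ⊢
    split_ifs at hi ⊢ with h
    · rw [h]; exact hi₀val
    · exact hfixed i hi
  · by_cases h : i = i₀
    · rw [h, hi₀val, hεabs]
    by_cases hfree : Γ.chart j i = 0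
    · -- a free coordinate other than `i*`
      have hmin := hV.exit_min j hj i hfree
      rw [← hy, ← hs, ← hc] at hmin
      rw [hstep]
      rcases lt_trichotomy (y i - s i) 0 with hneg | hzero | hpos
      · -- moving down: bounded below by `-1` (minimality), above by `y i` or `0`
        have hle : c ≤ (1 + s i) / (s i - y i) := hmin.2 hneg
        have hlow : -1 ≤ s i + c * (y i - s i) := by
          have h1 : c * (s i - y i) ≤ 1 + s i := by
            rwa [le_div_iff₀ (by linarith)] at hle
          linarith
        have hup : s i + c * (y i - s i) ≤ 1 := by
          rcases Nat.eq_zero_or_pos j with h0 | hpos'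
          · have : s i = 0 := by rw [hs0 h0]; rfl
            rw [this]; nlinarith
          · have h1 : y i ≤ 1 := (abs_le.1 (hcube hpos' i)).2
            have h2 : 1 ≤ c := hc1 hpos'
            nlinarith
        exact abs_le.2 ⟨hlow, hup⟩
      · rw [hzero, mul_zero, add_zero]
        rcases Nat.eq_zero_or_pos j with h0 | hpos'
        · have : s i = 0 := by rw [hs0 h0]; rfl
          rw [this]; simp
        · have : s i = y i := by linarith
          rw [this]; exact hcube hpos' i
      · have hle : c ≤ (1 - s i) / (y i - s i) := hmin.1 hpos
        have hup : s i + c * (y i - s i) ≤ 1 := by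
          have h1 : c * (y i - s i) ≤ 1 - s i := by rwa [le_div_iff₀ hpos] at hle
          linarith
        have hlow : -1 ≤ s i + c * (y i - s i) := by
          rcases Nat.eq_zero_or_pos j with h0 | hpos'
          · have : s i = 0 := by rw [hs0 h0]; rfl
            rw [this]; nlinarith
          · have h1 : -1 ≤ y i := (abs_le.1 (hcube hpos' i)).1
            have h2 : 1 ≤ c := hc1 hpos'
            nlinarith
        exact abs_le.2 ⟨hlow, hup⟩
    · rw [hfixed i hfree]
      rcases chart_trichotomy hV j hj.le i with h0 | h1 | h1
      · exact absurd h0 hfree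
      · simp [h1]
      · simp [h1]

/-- **The projected points lie in the unit cubes of their charts** (`1 ≤ j ≤ J`).
[cite: FournierKoiran2000, §2.1 (recursion on the cube `[-1,1]^{n-k+1}` of the affine space of step `k`)] -/
theorem xProj_mem_unitCube (hV : Γ.Valid xh B r) :
    ∀ j, j ≤ Γ.J → (∀ i, Γ.chart j i ≠ 0 → Γ.xProj xh j i = Γ.chart j i) ∧
      (1 ≤ j → ∀ i, |Γ.xProj xh j i| ≤ 1) := by
  intro j
  induction j with
  | zero => intro _; exact ⟨fun i h => absurd rfl h, fun h => absurd h (by omega)⟩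
  | succ j ih =>
    intro hj
    have h := xProj_succ_mem hV (by omega) (ih (by omega)).1 (ih (by omega)).2
    exact ⟨h.1, fun _ => h.2⟩

/-! ### The upward invariant -/

/-- `lin` at an apex, from the rational sum. [folklore] -/
theorem lin_sR (Γ : Cert D) (a : Fin D → ℤ) (j : ℕ) :
    lin a (Γ.sR j) = ((∑ i, (a i : ℚ) * Γ.s j i : ℚ) : ℝ) := by
  rw [Rat.cast_sum]
  refine sum_congr rfl fun i _ => ?_
  simp [sR]

/-- Live families shrink. [folklore] -/
theorem Live.mono {a : Fin D → ℤ} {j j' : ℕ} (h : Γ.Live B j a) (hj : j' ≤ j) : Γ.Live B j' a :=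
  ⟨h.1, fun k hk => h.2 k (by omega)⟩

/-- **Upward invariant**: a live form has the same sign at `x^{(j)}` as at `x̂`
(`ℓ ∈ Λ_{j+1} ⇒ ℓ(s_j) = 0 ⇒ ℓ(x^{(j+1)}) = μ*_j ℓ(x^{(j)})`, `μ*_j > 0`).
[cite: FournierKoiran2000, §2.1 Lemma 2 (tests on the projected point are tests `Aff(s, h')` on `x`)] -/
theorem sign_lin_xProj (hV : Γ.Valid xh B r) :
    ∀ j, j ≤ Γ.J → ∀ a, Γ.Live B j a →
      SignType.sign (lin a (Γ.xProj xh j)) = SignType.sign (lin a xh) := by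
  intro j
  induction j with
  | zero => intro _ a _; rfl
  | succ j ih =>
    intro hj a ha
    have hj' : j < Γ.J := by omega
    have hcube := (xProj_mem_unitCube hV j hj'.le).2
    obtain ⟨-, -, -, -, hcpos, -⟩ := exit_facts hV hj' (fun h => hcube h _)
    have hs : lin a (Γ.sR j) = 0 := by
      rw [lin_sR, ha.2 j (by omega), Rat.cast_zero]
    rw [xProj_succ, lin_apex, hs, zero_add, sub_zero, sign_mul, sign_pos hcpos, one_mul]
    exact ih hj'.le a (ha.mono (by omega))

/-! ### The downward invariant and the main theorem -/

/-- The un-projected point `x*^{(J-k)}` as a real vector. [folklore] -/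
def xR (Γ : Cert D) (k : ℕ) : Fin D → ℝ := fun i => (Γ.xStarRev k i : ℝ)

/-- Unfolding of `xR (k+1)`. [folklore] -/
theorem xR_succ (Γ : Cert D) (k : ℕ) :
    Γ.xR (k + 1) = Γ.sR (Γ.J - (k + 1)) +
      ((Γ.μ (Γ.J - (k + 1)) : ℚ) : ℝ) • (Γ.xR k - Γ.sR (Γ.J - (k + 1))) := by
  funext i
  simp only [xR, xStarRev, sR, Pi.add_apply, Pi.smul_apply, Pi.sub_apply, smul_eq_mul]
  push_cast
  ring

/-- Size of the apexes: `|s_j|_∞ ≤ 3/2` (`1 ≤ j ≤ J`): fixed coordinates are `±1`, free ones are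
within `ρ_j/4 + r ≤ 1/2` of a point of the unit cube. [folklore] -/
theorem abs_sR_le (hV : Γ.Valid xh B r) {j : ℕ} (hj1 : 1 ≤ j) (hj : j ≤ Γ.J) (i : Fin D) :
    |Γ.sR j i| ≤ 3 / 2 := by
  by_cases h : Γ.chart j i = 0
  · have h1 : |(Γ.s j i : ℝ) - Γ.p j i| ≤ Γ.ρ j / 4 := by
      have := hV.s_near j hj1 hj i h; exact_mod_cast this
    have h2 : |Γ.xProj xh j i - Γ.p j i| ≤ r := hV.x_near j hj1 hj i h
    have h3 : |Γ.xProj xh j i| ≤ 1 := (xProj_mem_unitCube hV j hj).2 hj1 i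
    have h4 : (r : ℝ) ≤ Γ.ρ j / 4 ∧ (Γ.ρ j : ℝ) ≤ 1 := by
      have := hV.rho j hj1 hj; exact ⟨by exact_mod_cast this.2.1, by exact_mod_cast this.2.2⟩
    rw [abs_le] at h1 h2 h3 ⊢
    simp only [sR]
    constructor <;> linarith [h4.1, h4.2]
  · rw [sR_fixed hV hj h]
    rcases chart_trichotomy hV j hj i with h0 | h1 | h1
    · exact absurd h0 h
    · rw [h1]; norm_num
    · rw [h1]; norm_num

/-- **Downward invariant**: for `k ≤ J` and `j = J - k`, the un-projected point `x*^{(j)}` has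
sup-norm `≤ 2`, lies in the chart `G_j`, and every live form of level `j` has the same sign at
`x*^{(j)}` as at `x^{(j)}`. [cite: FournierKoiran2000, §2.4 and p. 11 (a point of the located set `P_S` decides like `x`)] -/
theorem sign_lin_xStarRev (hV : Γ.Valid xh B r) :
    ∀ k, k ≤ Γ.J →
      (∀ i, |Γ.xR k i| ≤ 2) ∧
      (∀ i, Γ.chart (Γ.J - k) i ≠ 0 → Γ.xR k i = Γ.chart (Γ.J - k) i) ∧
      (∀ a, Γ.Live B (Γ.J - k) a →
        SignType.sign (lin a (Γ.xR k)) = SignType.sign (lin a (Γ.xProj xh (Γ.J - k)))) := by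
  intro k
  induction k with
  | zero =>
    intro _
    have h0 : Γ.xR 0 = Γ.sR Γ.J := rfl
    rw [Nat.sub_zero, h0]
    refine ⟨fun i => ?_, fun i hi => sR_fixed hV le_rfl hi, fun a _ => by rw [hV.bottom]⟩
    rcases Nat.eq_zero_or_pos Γ.J with hJ | hJ
    · rw [hJ, sR_zero hV]; simp
    · exact (abs_sR_le hV hJ le_rfl i).trans (by norm_num)
  | succ k ih =>
    intro hk
    obtain ⟨iha, ihb, ihc⟩ := ih (by omega)
    set j := Γ.J - (k + 1) with hjdef
    have hj1 : Γ.J - k = j + 1 := by omega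
    have hjJ : j < Γ.J := by omega
    rw [hj1] at ihb ihc
    have hμ : (0 : ℝ) < Γ.μ j ∧ ((Γ.μ j : ℝ) ≤ 1 / 16 ∨ j = 0) := by
      rcases Nat.eq_zero_or_pos j with h0 | hpos
      · simp [μ, h0]
      · have hρ := hV.rho j hpos hjJ.le
        have hμq : Γ.μ j = Γ.ρ j / 16 := by simp [μ, hpos.ne']
        have hρ1 : (Γ.ρ j : ℝ) ≤ 1 := by exact_mod_cast hρ.2.2
        have hρ0 : (0 : ℝ) < Γ.ρ j := by exact_mod_cast hρ.1
        have hcast : ((Γ.μ j : ℚ) : ℝ) = (Γ.ρ j : ℝ) / 16 := by rw [hμq]; push_cast; ring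
        rw [hcast]
        exact ⟨by positivity, Or.inl (by linarith)⟩
    have hformula : ∀ i, Γ.xR (k + 1) i = Γ.sR j i + (Γ.μ j : ℝ) * (Γ.xR k i - Γ.sR j i) := by
      intro i
      have := congrFun (Γ.xR_succ k) i
      simpa [← hjdef] using this
    -- (b) chart membership
    have hb : ∀ i, Γ.chart j i ≠ 0 → Γ.xR (k + 1) i = Γ.chart j i := by
      intro i hi
      have h1 : Γ.chart (j + 1) i = Γ.chart j i := chart_succ_of_ne_zero hV hjJ hi
      have h2 : Γ.xR k i = Γ.chart j i := by rw [← h1]; exact ihb i (by rwa [h1])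
      rw [hformula, h2, sR_fixed hV hjJ.le hi]; ring
    -- (a) size, and distance to the apex at levels `j ≥ 1`
    have hdist : 1 ≤ j → ∀ i, |Γ.xR (k + 1) i - Γ.sR j i| ≤ Γ.ρ j / 4 := by
      intro hpos i
      have hμ' : (Γ.μ j : ℝ) = Γ.ρ j / 16 := by
        have : Γ.μ j = Γ.ρ j / 16 := by simp [μ, (show j ≠ 0 by omega)]
        rw [this]; push_cast; ring
      rw [hformula, add_sub_cancel_left, abs_mul, hμ']
      have hρ0 : (0 : ℝ) ≤ Γ.ρ j := by
        have := (hV.rho j hpos hjJ.le).1; exact_mod_cast this.le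
      rw [abs_of_nonneg (by positivity)]
      have h1 : |Γ.xR k i - Γ.sR j i| ≤ 4 := by
        calc |Γ.xR k i - Γ.sR j i| ≤ |Γ.xR k i| + |Γ.sR j i| := abs_sub _ _
          _ ≤ 2 + 3 / 2 := add_le_add (iha i) (abs_sR_le hV hpos hjJ.le i)
          _ ≤ 4 := by norm_num
      nlinarith
    have ha : ∀ i, |Γ.xR (k + 1) i| ≤ 2 := by
      intro i
      rcases Nat.eq_zero_or_pos j with h0 | hpos
      · have : Γ.xR (k + 1) i = Γ.xR k i := by
          rw [hformula, h0, sR_zero hV]; simp [μ]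
        rw [this]; exact iha i
      · have hρ1 : (Γ.ρ j : ℝ) ≤ 1 := by exact_mod_cast (hV.rho j hpos hjJ.le).2.2
        calc |Γ.xR (k + 1) i| ≤ |Γ.xR (k + 1) i - Γ.sR j i| + |Γ.sR j i| := by
              have := abs_add_le (Γ.xR (k + 1) i - Γ.sR j i) (Γ.sR j i); rwa [sub_add_cancel] at this
          _ ≤ Γ.ρ j / 4 + 3 / 2 := add_le_add (hdist hpos i) (abs_sR_le hV hpos hjJ.le i)
          _ ≤ 2 := by linarith
    refine ⟨ha, hb, fun a hlive => ?_⟩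
    -- (c) signs
    by_cases hsum : ∑ i, (a i : ℚ) * Γ.s j i = 0
    · -- the form is live at level `j+1` too
      have hlive' : Γ.Live B (j + 1) a := ⟨hlive.1, fun j' hj' => by
        rcases Nat.lt_succ_iff_lt_or_eq.1 hj' with h | h
        · exact hlive.2 j' h
        · rw [h]; exact hsum⟩
      have hs0 : lin a (Γ.sR j) = 0 := by rw [lin_sR, hsum, Rat.cast_zero]
      have h1 : lin a (Γ.xR (k + 1)) = (Γ.μ j : ℝ) * lin a (Γ.xR k) := by
        rw [Γ.xR_succ k, ← hjdef, lin_apex, hs0]; ring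
      rw [h1, sign_mul, sign_pos hμ.1, one_mul, ihc a hlive',
        sign_lin_xProj hV (j + 1) (by omega) a hlive', ← sign_lin_xProj hV j hjJ.le a hlive]
    · -- the form is excluded at level `j ≥ 1`: no zero on `Q_j`, which contains both points
      have hpos : 1 ≤ j := by
        rcases Nat.eq_zero_or_pos j with h0 | h; swap; · exact h
        exfalso; apply hsum
        simp [h0, hV.s_zero]
      have hnot : ¬ Meets (Γ.chart j) (Γ.p j) (Γ.ρ j) a :=
        fun hm => hsum (hV.apex j hpos hjJ.le a hlive hm)
      have hρ := hV.rho j hpos hjJ.le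
      have hx : InCube (Γ.chart j) (Γ.p j) (Γ.ρ j) (Γ.xProj xh j) := by
        refine ⟨(xProj_mem_unitCube hV j hjJ.le).1, fun i hi => ?_⟩
        have := hV.x_near j hpos hjJ.le i hi
        have h4 : (r : ℝ) ≤ Γ.ρ j := by
          exact_mod_cast (by linarith [hρ.1, hρ.2.1] : r ≤ Γ.ρ j)
        exact this.trans h4
      have hxs : InCube (Γ.chart j) (Γ.p j) (Γ.ρ j) (Γ.xR (k + 1)) := by
        refine ⟨hb, fun i hi => ?_⟩
        have h1 := hdist hpos i
        have h2 : |Γ.sR j i - Γ.p j i| ≤ Γ.ρ j / 4 := by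
          have := hV.s_near j hpos hjJ.le i hi
          simp only [sR]; exact_mod_cast this
        calc |Γ.xR (k + 1) i - Γ.p j i|
            ≤ |Γ.xR (k + 1) i - Γ.sR j i| + |Γ.sR j i - Γ.p j i| := abs_sub_le _ _ _
          _ ≤ Γ.ρ j / 4 + Γ.ρ j / 4 := add_le_add h1 h2
          _ ≤ Γ.ρ j := by
              have : (0 : ℝ) ≤ Γ.ρ j := by exact_mod_cast hρ.1.le
              linarith
      exact (sign_lin_eq_of_not_meets hnot hx hxs).symm

/-- **Correctness of location certificates.** If `Γ` is valid for `x̂` then the located rational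
point `x* = xStar 0` lies in the same face of the arrangement of all integer forms with
`|a|_∞ ≤ B` as `x̂`: `sign ℓ_a(x*) = sign ℓ_a(x̂)`. [cite: FournierKoiran2000, Thm 2 with §2.4 and Thm 3 p. 11 (the located set `P_S` lies in one face of `𝒜(𝓗_n)`; a rational point of it decides membership)] -/
theorem sign_lin_xStar_eq (hV : Γ.Valid xh B r) (a : Fin D → ℤ) (ha : ∀ i, (a i).natAbs ≤ B) :
    SignType.sign (lin a fun i => (Γ.xStar 0 i : ℝ)) = SignType.sign (lin a xh) := by
  have h := (sign_lin_xStarRev hV Γ.J le_rfl).2.2 a ⟨ha, fun j' hj' => absurd hj' (by omega)⟩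
  simp only [Nat.sub_self] at h
  exact h

/-- The located point has sup-norm `≤ 2`. [folklore] -/
theorem abs_xStar_zero_le (hV : Γ.Valid xh B r) (i : Fin D) : |(Γ.xStar 0 i : ℝ)| ≤ 2 :=
  (sign_lin_xStarRev hV Γ.J le_rfl).1 i

end Cert

end FKPointLocation

end Literature.Computability.Complexity
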